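import Mathlib
import HarnessLib
import Summits.HubbardSuperconductivity.HubbardSuperconductivity.Theorems.WeakCouplingBCSDefsKlCertB1gTPm03D0125Record
import Summits.HubbardSuperconductivity.HubbardSuperconductivity.Theorems.WeakCouplingBCSKlCertTPrimeWindowOfEngineRows

/-!
# Route `WeakCouplingBCS` — certificate half of `WcbcsKohnLuttingerB1g` (stmt-HubbardSuperconductivity-0158):
# the `(⅛, −0.3)` record `klCertB1gTPm03D0125` with its ANALYTIC hypothesis replaced by THREE NUMERICAL ENGINE ROWS

`klCertB1gTPm03D0125_dominates` (`Theorems/WeakCouplingBCSDefsKlCertB1gTPm03D0125Record.lean`, p714295) concludes `KLB1gDominatesTP (-3/10) mub mua gamma`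
modulo (a) the enclosures `EnclosuresB1gTP c (-3/10)` and (b) the abstract analytic facts `KLTPAnalytic ε_{−0.3} μ` on the box.  By the generic engine-rows form
`kltp_window_U_of_engineRows` / `kltp_window_of_engineRows` (`Theorems/WeakCouplingBCSKlCertTPrimeWindowOfEngineRows.lean`), (b) follows from three statements of
the same KIND as (a) — explicit inequalities between integrals/functions of the tree and rationals — which the cell's interval engine certifies (gate cell
`gate-hubbard-kl`, `HOME/margin-1-g17/stage2j/out/engine_rows.json`, impl-1 arithmetic on the production table j326170 / geometry geomtp2; CLAIMED numbers):
* (E1) SPEED FLOOR `37/25 ≤ ‖∇ε_{−0.3}(k)‖²` on the Fermi curve for every `μ` of the box (engine: `‖∇ε‖ ∈ [1.216841, 2.306421]`, `1.216841² = 1.4807 > 1.48`);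
* (E2) SUP BOUND `|χ₀[ε_{−0.3}](k + k′)| ≤ 53/100` for `k, k′` on the Fermi curve (engine: table sup `0.503122 ≤ UBF = 0.53`; `χ₀ ≥ 0`);
* (E3) POSITIVITY `9/10 ≤ ∫ u² dσ` for ONE trial per rival channel: table indices `1` (`A1g`), `5` (`A2g`), `9` (`B2g`), `12` (`E`, the `x`-member of the first doublet)
  (engine: `≥ 0.99955 / 0.99312 / 0.99743 / 0.99690`); the `B1g` witness is the record's own Ritz trial (`0 < Nlo ≤ ∫ Φ² dσ`, part of `checkB1gD` + E1).
Result: `klCertB1gTPm03D0125_dominates_of_engineRows` / `_dominatesAt_of_engineRows` — the record's conclusions MODULO (E1)–(E3) and `EnclosuresB1gTP (-3/10)`, with NO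
abstract analytic hypothesis left.  Honest framing: ONE cell `(δ, t′) = (⅛, −3/10)`; `B1g` dominance MODULO named numerical hypotheses (enclosures + engine rows), none
proved here; `γ = 33811/2²⁰ = +0.0322` in the separate-enclosure currency (docket option (δ)) — NOT the DECIDED pairwise `+0.0435`, beside which it is printed; nothing
about other cells, `K₃`, `U₀`, the window or superconductivity; a Kohn–Luttinger `O(U²)` channel statement is not ODLRO; nothing here proves superconductivity in the
Hubbard model.
References: S. Raghu, S. A. Kivelson, D. J. Scalapino, Phys. Rev. B 81 (2010) 224505, §II (5)–(8), §III (17) and Fig. 3.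
-/

noncomputable section

-- the tree's namespace `Summit.<Summit>.<Problem>.Theorems` repeats the summit name by design (D-0017)
set_option linter.dupNamespace false

namespace Summit.HubbardSuperconductivity.HubbardSuperconductivity.Theorems

open MeasureTheory Real CwKLChiralWindow Literature.MathematicalPhysics.QuantumLattice

/-- The rival-channel trial witnesses of the record: table indices `1, 5, 9, 12` fit `A1g, A2g, B2g, E` (kernel decision). [folklore] -/
theorem klCertB1gTPm03D0125_rival_fits :
    (klTab klCertB1gTPm03D0125.trials 1).fits D4Irrep.A1g = true ∧ (klTab klCertB1gTPm03D0125.trials 5).fits D4Irrep.A2g = true ∧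
      (klTab klCertB1gTPm03D0125.trials 9).fits D4Irrep.B2g = true ∧ (klTab klCertB1gTPm03D0125.trials 12).fits D4Irrep.E = true := by
  decide +kernel

/-- **The `(⅛, −0.3)` record's weak-coupling dominance from ENGINE ROWS**: if, for every `μ` of the record's box, (E1) `37/25 ≤ ‖∇ε_{−0.3}‖²` on the Fermi curve,
(E2) `|χ₀[ε_{−0.3}](k + k′)| ≤ 53/100` on `F × F`, (E3) `9/10 ≤ ∫ u_i² dσ` for the table entries `i = 1, 5, 9, 12`, and (E4) the record's enclosures
`EnclosuresB1gTP (-3/10)` hold, then `KLB1gDominatesTP (-3/10) mub mua gamma`: `channelInf ε μ U B1g + gamma·U² ≤ channelInf ε μ U χ` for every `μ` of the box,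
`0 < U < 1`, `χ ≠ B1g`. [cite: RaghuKivelsonScalapino2010, §II (5)-(8) and §III Fig. 3] -/
theorem klCertB1gTPm03D0125_dominates_of_engineRows
    (hspeed : ∀ bx ∈ klCertB1gTPm03D0125.boxes, ∀ μ ∈ Set.Icc (bx.mulo : ℝ) (bx.muhi : ℝ),
      ∀ k ∈ fermiCurve (squareDispersion 1 (-3 / 10)) μ,
        (37 / 25 : ℝ) ≤ (2 * sin (k 0) * (1 + 2 * (-3 / 10 : ℝ) * cos (k 1))) ^ 2 + (2 * sin (k 1) * (1 + 2 * (-3 / 10 : ℝ) * cos (k 0))) ^ 2)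
    (hC : ∀ bx ∈ klCertB1gTPm03D0125.boxes, ∀ μ ∈ Set.Icc (bx.mulo : ℝ) (bx.muhi : ℝ),
      ∀ k ∈ fermiCurve (squareDispersion 1 (-3 / 10)) μ, ∀ k' ∈ fermiCurve (squareDispersion 1 (-3 / 10)) μ,
        |lindhardFunction (squareDispersion 1 (-3 / 10)) μ (k + k')| ≤ 53 / 100)
    (hpos : ∀ bx ∈ klCertB1gTPm03D0125.boxes, ∀ μ ∈ Set.Icc (bx.mulo : ℝ) (bx.muhi : ℝ), ∀ i ∈ [1, 5, 9, 12],
      (9 / 10 : ℝ) ≤ ∫ k, (klTab klCertB1gTPm03D0125.trials i).toFun k ^ 2 ∂fermiCurveMeasure (squareDispersion 1 (-3 / 10)) μ)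
    (hE : klCertB1gTPm03D0125.EnclosuresB1gTP (-3 / 10)) :
    KLB1gDominatesTP (-3 / 10) ((klCertB1gTPm03D0125.mub : ℚ) : ℝ) ((klCertB1gTPm03D0125.mua : ℚ) : ℝ)
      ((klCertB1gTPm03D0125.gamma : ℚ) : ℝ) := by
  obtain ⟨h1, h5, h9, h12⟩ := klCertB1gTPm03D0125_rival_fits
  refine kltp_window_U_of_engineRows (-3 / 10) klCertB1gTPm03D0125 klCertB1gTPm03D0125_check (w := 37 / 25) (C := 53 / 100)
    (by norm_num) hspeed hC (fun bx hbx μ hμ χ hχ => ?_) hE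
  have hp : ∀ i ∈ [1, 5, 9, 12], 0 < ∫ k, (klTab klCertB1gTPm03D0125.trials i).toFun k ^ 2
      ∂fermiCurveMeasure (squareDispersion 1 (-3 / 10)) μ :=
    fun i hi => lt_of_lt_of_le (by norm_num) (hpos bx hbx μ hμ i hi)
  cases χ with
  | A1g => exact ⟨1, h1, hp 1 (by simp)⟩
  | A2g => exact ⟨5, h5, hp 5 (by simp)⟩
  | B1g => exact absurd rfl hχ
  | B2g => exact ⟨9, h9, hp 9 (by simp)⟩
  | E => exact ⟨12, h12, hp 12 (by simp)⟩

/-- The `U = 1` form from the same engine rows: `KLB1gDominatesAtTP (-3/10) mub mua gamma`. [cite: RaghuKivelsonScalapino2010, §III Fig. 3] -/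
theorem klCertB1gTPm03D0125_dominatesAt_of_engineRows
    (hspeed : ∀ bx ∈ klCertB1gTPm03D0125.boxes, ∀ μ ∈ Set.Icc (bx.mulo : ℝ) (bx.muhi : ℝ),
      ∀ k ∈ fermiCurve (squareDispersion 1 (-3 / 10)) μ,
        (37 / 25 : ℝ) ≤ (2 * sin (k 0) * (1 + 2 * (-3 / 10 : ℝ) * cos (k 1))) ^ 2 + (2 * sin (k 1) * (1 + 2 * (-3 / 10 : ℝ) * cos (k 0))) ^ 2)
    (hC : ∀ bx ∈ klCertB1gTPm03D0125.boxes, ∀ μ ∈ Set.Icc (bx.mulo : ℝ) (bx.muhi : ℝ),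
      ∀ k ∈ fermiCurve (squareDispersion 1 (-3 / 10)) μ, ∀ k' ∈ fermiCurve (squareDispersion 1 (-3 / 10)) μ,
        |lindhardFunction (squareDispersion 1 (-3 / 10)) μ (k + k')| ≤ 53 / 100)
    (hpos : ∀ bx ∈ klCertB1gTPm03D0125.boxes, ∀ μ ∈ Set.Icc (bx.mulo : ℝ) (bx.muhi : ℝ), ∀ i ∈ [1, 5, 9, 12],
      (9 / 10 : ℝ) ≤ ∫ k, (klTab klCertB1gTPm03D0125.trials i).toFun k ^ 2 ∂fermiCurveMeasure (squareDispersion 1 (-3 / 10)) μ)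
    (hE : klCertB1gTPm03D0125.EnclosuresB1gTP (-3 / 10)) :
    KLB1gDominatesAtTP (-3 / 10) ((klCertB1gTPm03D0125.mub : ℚ) : ℝ) ((klCertB1gTPm03D0125.mua : ℚ) : ℝ)
      ((klCertB1gTPm03D0125.gamma : ℚ) : ℝ) := by
  obtain ⟨h1, h5, h9, h12⟩ := klCertB1gTPm03D0125_rival_fits
  refine kltp_window_of_engineRows (-3 / 10) klCertB1gTPm03D0125 klCertB1gTPm03D0125_check (w := 37 / 25) (C := 53 / 100)
    (by norm_num) hspeed hC (fun bx hbx μ hμ χ hχ => ?_) hE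
  have hp : ∀ i ∈ [1, 5, 9, 12], 0 < ∫ k, (klTab klCertB1gTPm03D0125.trials i).toFun k ^ 2
      ∂fermiCurveMeasure (squareDispersion 1 (-3 / 10)) μ :=
    fun i hi => lt_of_lt_of_le (by norm_num) (hpos bx hbx μ hμ i hi)
  cases χ with
  | A1g => exact ⟨1, h1, hp 1 (by simp)⟩
  | A2g => exact ⟨5, h5, hp 5 (by simp)⟩
  | B1g => exact absurd rfl hχ
  | B2g => exact ⟨9, h9, hp 9 (by simp)⟩
  | E => exact ⟨12, h12, hp 12 (by simp)⟩

end Summit.HubbardSuperconductivity.HubbardSuperconductivity.Theorems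

end
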